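import Summits.BirchSwinnertonDyer.BirchSwinnertonDyer.Theses.KolyvaginRankRigidityAtTwo
import Literature.NumberTheory.EllipticCurves.HeegnerPointsOfConductorOneGaloisConjProofs
import Literature.NumberTheory.EllipticCurves.BSDSelmerPConverseYanZhuKolyvaginSystemProofs
import Literature.NumberTheory.EllipticCurves.LeadingTermProofs
import Literature.NumberTheory.EllipticCurves.SelmerCorankHolds
import Literature.NumberTheory.EllipticCurves.MordellWeilTheoremProofs
import HarnessLib

/-!
# Crux V2♭ `KolyvaginCorankLowerBoundAtTwo` (stmt-BirchSwinnertonDyer-24623), line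
# `kolyvagin_depth_split`, stub `stub_depthZero`: the depth-zero cell, UNCONDITIONALLY

At a non-zero conductor-`1` class `c_M(1) ≠ 0` of the Heegner-point Kolyvagin system at `p = 2`
(depth `ν = #(ℓ ∣ n) = 0`, so `n = 1`), one of the two `ℤ₂`-coranks
`c = corank Sel_{2^∞}(E/ℚ)`, `c' = corank Sel_{2^∞}(E^{(d_K)}/ℚ)` is at least `1 = ν + 1`.

Proof (no Gross–Zagier, no printed input — Mordell–Weil only): `c_M(1) ≠ 0` forces the derived
point `P(1) = Tr_{K[1]/K} y(1)` to be of infinite order (a torsion `P(1)` is `2^M`-divisible in the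
admissible group `E(K[1])`, Gross 1991 Prop. 4.7 (1), tree theorem
`heegnerSystem_kolyvaginClass_eq_zero_of_isOfFinAddOrder`); `P(1)` descends to a point
`P₀ ∈ E(K)` (Gross 1991 §4 `P_1 = y_K`; tree theorem
`heegnerSystem_exists_isHeegnerPoint_map_eq_derivedPoint_one`, whose reciprocity input at conductor
`1` is the tree THEOREM `heegnerPointOfConductor_one_galoisConj_holds`), still of infinite order;
so `1 ≤ rank E(K) = rank E(ℚ) + rank E^{(d_K)}(ℚ)` (Mordell–Weil `module_finite_point_holds`,
Silverman AEC Ex. 10.16 `mordellWeilRank_baseChange_quadratic_holds`), and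
`corank Sel_{2^∞} = rank + corank Ш[2^∞] ≥ rank` for both curves
(`selmerCorank_eq_mordellWeilRank_add_holds`, Greenberg 1999 §1).

HONEST FRAMING: this is the EASY cell of V2♭ (the only one the route's `closes` consumes); the
positive-depth stub `stub_posDepth` carries the beyond-print content. BSD is not proved here.
-/

set_option autoImplicit false
-- the Theorems namespace of this sub repeats the summit name by design (D-0017 nested layout)
set_option linter.dupNamespace false

noncomputable section

open scoped Classical

open WeierstrassCurve Literature.NumberTheory.EllipticCurves
  Literature.NumberTheory.EllipticCurves.ModularForms
open Summit.BirchSwinnertonDyer.BirchSwinnertonDyer.Theses.KolyvaginRankRigidityAtTwo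

namespace Summit.BirchSwinnertonDyer.BirchSwinnertonDyer.Theorems.KolyvaginLowerBoundAtTwo

/-- **Depth `ν = 0` of V2♭ `KolyvaginCorankLowerBoundAtTwo`, unconditionally** (registered stub
`stub_depthZero` of line `kolyvagin_depth_split` on stmt-BirchSwinnertonDyer-24623): on V2♭'s
habitat, a non-zero class `c_M(n) ≠ 0` with `#(ℓ ∣ n) = 0` (so `n = 1`) forces
`1 ≤ corank Sel_{2^∞}(E/ℚ) ∨ 1 ≤ corank Sel_{2^∞}(E^{(d_K)}/ℚ)`: `P(1) = y_K` has infinite order,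
so `1 ≤ rank E(K) = rank E(ℚ) + rank E^{(d_K)}(ℚ) ≤ c + c'`. (Most binders are idle in this cell
and kept only to match the registered signature.)
[cite: GrossLMS1991, §4 (4.1) (P_1 = y_K) and Prop. 4.7 (1)] [cite: SilvermanAEC2009, Exercise 10.16]
[cite: Greenberg1999LNM, §1 pp. 53–57] -/
theorem stub_depthZero :
    ∀ (W : WeierstrassCurve ℚ) [W.IsElliptic] [W.IsGloballyMinimal], ¬ W.HasCM →
      (Rank1Residual.GoodOrd W 2 ∨ Rank1Residual.Mult W 2) →
      (∀ m : ℕ, W.HasSurjectiveModNGaloisRep (2 ^ m : ℕ)) →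
      ∀ (K : Type) [Field K] [NumberField K], IsImaginaryQuadratic K → NumberField.discr K ≠ -3 →
      NumberField.discr K ≠ -4 → ¬ ((2 : ℤ) ∣ NumberField.discr K) → ∀ [NeZero (W.conductorNorm ℤ)],
      SatisfiesHeegnerHypothesis (W.conductorNorm ℤ) K →
      ∀ (Dt : ModularParametrizationData W (W.conductorNorm ℤ)) (β : ℤ) (ι : K →+* ℂ) (n : ℕ)
        (d : KolyvaginHeegnerData Dt β ι n) (M : ℕ),
        KolyvaginDescent.KolSupp (Zhang2014.IsKolyvaginPrime (W.conductorNorm ℤ) W K 2) n →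
        1 ≤ M → (M : ℕ∞) ≤ Zhang2014.levelIndex W 2 n → d.kolyvaginClass Nat.prime_two M ≠ 0 →
        (∀ (n' : ℕ) (d' : KolyvaginHeegnerData Dt β ι n') (M' : ℕ),
          KolyvaginDescent.KolSupp (Zhang2014.IsKolyvaginPrime (W.conductorNorm ℤ) W K 2) n' →
          1 ≤ M' → (M' : ℕ∞) ≤ Zhang2014.levelIndex W 2 n' → d'.kolyvaginClass Nat.prime_two M' ≠ 0 →
          n.primeFactors.card ≤ n'.primeFactors.card) →
        n.primeFactors.card = 0 →
        (n.primeFactors.card + 1 ≤ W.selmerCorank 2 ∨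
          n.primeFactors.card + 1 ≤ (W.quadraticTwist (NumberField.discr K : ℚ)).selmerCorank 2) := by
  intro W _ _ _ _ _ K _ _ hK _ _ _ _ hHN Dt β ι n d M hn _ _ hne _ hν
  -- `n` is square-free with no prime factor: `n = 1`
  have hn1 : n = 1 := by
    rw [Finset.card_eq_zero, Nat.primeFactors_eq_empty] at hν
    rcases hν with h0 | h1
    · exact absurd (h0 ▸ hn.1) not_squarefree_zero
    · exact h1
  subst hn1
  rw [hν]
  haveI : Fact (Nat.Prime 2) := ⟨Nat.prime_two⟩
  -- `c_M(1) ≠ 0` forces `P(1)` to have infinite order (Gross 1991, Prop. 4.7 (1))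
  have hnt : ¬ IsOfFinAddOrder d.derivedPoint := fun hfin ↦
    hne (heegnerSystem_kolyvaginClass_eq_zero_of_isOfFinAddOrder d Nat.prime_two M hfin)
  -- `P(1) = Tr_{K[1]/K} y(1)` descends to `P₀ ∈ E(K)` (reciprocity at conductor `1` is a theorem)
  obtain ⟨P₀, -, hP₀⟩ := heegnerSystem_exists_isHeegnerPoint_map_eq_derivedPoint_one
    (heegnerPointOfConductor_one_galoisConj_holds _ W K) hK hHN d
  have hnt₀ : ¬ IsOfFinAddOrder P₀ := fun h ↦ hnt (hP₀ ▸
    (WeierstrassCurve.Affine.Point.map (W' := W)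
      (algebraMap K (ringClassField K ι 1)).toRatAlgHom).isOfFinAddOrder h)
  -- Mordell–Weil: `1 ≤ rank E(K) = rank E(ℚ) + rank E^{(d_K)}(ℚ)`
  haveI : (W.baseChange K).IsElliptic := by rw [baseChange]; infer_instance
  have hge : 1 ≤ (W.baseChange K).mordellWeilRank :=
    one_le_mordellWeilRank_of_not_isOfFinAddOrder _ (W.baseChange K).module_finite_point_holds hnt₀
  have hrk := mordellWeilRank_baseChange_quadratic_holds W K hK.1
  -- `corank Sel_{2^∞} = rank + corank Ш[2^∞]` for `E` and for `E^{(d_K)}`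
  have hd : (NumberField.discr K : ℚ) ≠ 0 := by exact_mod_cast NumberField.discr_ne_zero K
  haveI := W.isElliptic_quadraticTwist hd
  have hQ := W.selmerCorank_eq_mordellWeilRank_add_holds 2
  have hT := (W.quadraticTwist (NumberField.discr K : ℚ)).selmerCorank_eq_mordellWeilRank_add_holds 2
  omega

end Summit.BirchSwinnertonDyer.BirchSwinnertonDyer.Theorems.KolyvaginLowerBoundAtTwo

end
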